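import Summits.BirchSwinnertonDyer.BirchSwinnertonDyer.Theses.KatoDescentPotSupersingular
import Summits.BirchSwinnertonDyer.BirchSwinnertonDyer.Theorems.KatoDescentPotSupersingularWildJetchevBoundAtPOfStubs
import Summits.BirchSwinnertonDyer.BirchSwinnertonDyer.Theorems.KatoDescentPotSupersingularWildJetchevBoundAtPCoreVertexBridgePrimed
import Summits.BirchSwinnertonDyer.BirchSwinnertonDyer.Theorems.KatoDescentPotSupersingularWildJetchevBoundAtPNamedPrintOnly
import Summits.BirchSwinnertonDyer.BirchSwinnertonDyer.Theorems.KatoDescentPotSupersingularWildJetchevBoundAtPNamedPrintOnlyPB2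
import Summits.BirchSwinnertonDyer.BirchSwinnertonDyer.Theorems.KatoDescentTamePotSupersingularJetchevIrreducibleProp47OfGross37
import Summits.BirchSwinnertonDyer.BirchSwinnertonDyer.Theorems.Rank1ResidualJetRingClassFields
import HarnessLib

/-!
**ADOPTED as skeleton v5 by planner bsd-potss-plan g23 (2026-08-27T16:32Z)** — k8t-c4 g11's candidate
(`pub/bsd-potss/k8t-c4/WildJetchevBoundAtP_birth_v5c_candidate.lean`, sha16 e0d46a0b79057166) byte-identical below this note; supersedes the registered v4
(@ f82e70d3116e, archived `Lines/v4_closedLocalFactsAtP_g23.lean (ns .BirthV4)`). S5 RE-KEY DECISION (planner, INBOX 16:3xZ): keying **(i)** — the image-free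
`GrossLMS1991.prop37_2_frobeniusCongruence` ((A′) verbatim in print, bsd-cited r05 S12) with the `l ≠ 2` guard on the swapped prime;
the per-row inert fact v2 (`prop37_2_reductionCongruence_inert`, p539858) stays DERIVED from it for any later per-row consumer.
`lean check`: rc 0, seven `sorry`s = seven stubs, the `_of` compositions REAL proofs concluding the route decls BY NAME.
HONEST FRAMING unchanged: conditional skeleton; nothing booked; the crux and BSD as open as before.
-/

/-!
**JOINT v5 CANDIDATE "v5c" for crux 19941 (prover bsd-potss-k8t-c4 g11, 2026-08-27T16:xxZ; NOT registered — for the planner).**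
= k9-c4 g9's candidate `v5np` (below the second note, byte-identical except where said) WITH the S5 lane's re-cut merged in,
exactly as in 20165's joint candidate `v7c` (`pub/bsd-potss/k8t-c4/JetchevIrreducibleReadingByName_birth_v7c_candidate.lean`):
S5 `stub_prop44Irred` ↦ **`stub_prop47IrredP2`** (primed `(p : ℤ) ∣ W.conductorNorm ℤ`, (B)-only, `l ≠ 2`; text BYTE-FOR-BYTE
= 20165 v7c's, so the stub stays SHARED), **DISCHARGED modulo Gross 1991 Prop. 3.7 (2)** by
`stub_prop47IrredP2_of_prop37_2 := JetchevIrreducibleProp44.h47P2_of_prop37_2` (k8t-c4 g11 p541604); the H63Ip node through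
k8t-c4 g11's `WildJetchevBoundAtPNamedPrintOnlyPB2.…`-namespace twin `JetchevIrreducibleH63P2.thm63AtP_of_poitouTate_of_GZ31_of_prop47P2`
(= k9-c4's `…AtPNamedPrintOnly` re-keyed over `…LocalFactsNamedPrintPB2`). `lean check`: rc 0, seven `sorry`s = seven stubs.
HONEST FRAMING: conditional throughout; nothing booked; the crux, its stubs and BSD are as open as before.
-/

/-!
**CANDIDATE v5 (prover k9-c4 g9, 2026-08-27T14:3xZ) = registered v4 (plan g23 @ f82e70d3116e, sha16 f6d0b121cb95) with the hardest stub
`stub_thm52ClosedLocalFacts` (8 closed statements) RE-CUT to `stub_thm52NamedPrint` (2 closed NAMED-PRINT statements: hPT Poitou–Tate ∧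
hGZ [GZ86 III (3.1)] Kolyvagin-guarded), composed through k9-c4 g9's end form `WildJetchevBoundAtPNamedPrintOnly.thm63AtP_of_poitouTate_of_GZ31`
(Gross 5.3 struck at the point of use, p533295; the four local statements bsd-jet theorems, p531200; the last completion-layer gap h49str
— Jetchev Prop. 4.9 proper at the additive v ∣ p, the «new argument at v ∣ 3» — a theorem given hGZ, p535775). SHARED with the 20165 v7
candidate byte-for-byte (stub text and name). Everything below the adoption note is the registered v4 text except the stub block, the import
and the composition line; `lean check`: rc 0, sorries ONLY in `stub_*` (7 = stubs_max; 6 under R183's restate).**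

**ADOPTED as skeleton v4 by planner bsd-potss-plan g23 (2026-08-27T11:55Z)** — k9-c4 g8's candidate
(`pub/bsd-potss/k9-c4/g8/WildJetchevBoundAtP_birth_v4_candidate.lean`, sha16 9bbfc3f5f460c989) byte-identical below this
note EXCEPT one syntactic repair (a stray orphan docstring «Statement of `stub_publishedInputsHeegner` (cite) … byte-identical
to v1» left before `Sig.S2pDivisibilityAtP` with no declaration under it — an «unexpected token: doc-comment opener» error at the
candidate's l. 313 — deleted; the real `Sig.stub_publishedInputsHeegner` block further down is untouched); supersedes the registered v3
(sha 805451dd0dcc, archived `Lines/v3_kernelGapsAtP_g22.lean`, ns `.BirthV3`). `lean check` rc 0, seven `sorry`s = seven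
stubs (= stubs_max; six after the queued `d_K ≠ −4` restate drops `stub_gaussianSupplement`), `WildJetchevBoundAtP_of` a
REAL proof concluding the K9 decl by name. ALL SIX load-bearing stubs (S1, S2′, S3′, S5, S6 `stub_thm52ClosedLocalFacts`,
S7) are now byte-identical (up to one space of indentation in S2′/S3′, same terms) with 20165 v6 — one proof per stub
`--supports` both items. PLANNED v5 CUT: as 20165 v7 (S6 ↦ S6a published local inputs hPT/h53/hGZ + S6b local gaps
hloc/h𝒯σ/h𝒯sd/htr/h49str) at the `d_K ≠ −4` restate.
-/

/-!
# BC3 SKELETON v4 CANDIDATE (prover-written for the planner; = registered v3 with `stub_thm52KernelGapsAtP` REPLACED by k8t-c4 g10's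
# `stub_thm52ClosedLocalFacts` — BYTE-IDENTICAL with 20165 v6 candidate — through `thm63AtP_of_closedLocalFactsAtP` (p528465)) — crux `WildJetchevBoundAtP` (item
# stmt-BirchSwinnertonDyer-19941; route K9 = `Theses/KatoDescentPotSupersingular.lean`, rank 6); seat `bsd-potss-k9-c4` g8,
# 2026-08-27; supersedes v1 (`Lines/birth.lean` fa288a46e054: S1′ `stub_structure_depth_indexForm_d3` / S2′
# `stub_derivedPoint_divisible_at_additive_p`) IF the planner adopts it (only the planner's unit may `crux write`)

WHY v2. Three kernel files of k9-c4 g8 (all ACCEPTED, route-free except the first which imports the K9 route for the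
by-name §3): p518161 `…WildJetchevBoundAtPOfStubs` (the crux BY NAME from S1 + S2p + `PublishedInputsHeegner` + the
displayed `d_K = −4` supplement), p518685 `…WildJetchevBoundAtPSkeletonRekey` (v1's S1′/S2′ at `d_K ≠ −4` ⟸ S1 / S2p),
p520230 `…WildJetchevBoundAtPCoreVertexBridge` (S2p ⟸ prop52Irred + coreVertexExistenceIrred + hRCF + H63Ip; H63Ip ⟸
cor32Irred + prop44Irred + KernelGapsAtP, via k8t-c4's carrier-abstract assembly p508713 at `t := ord_p c_p`). So the
crux REDUCES to the shared crux 20165's registered stubs (skeleton v3: `stub_structureIrred`, `stub_prop52Irred`,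
`stub_coreVertexExistenceIrred`, `stub_cor32Irred`, `stub_prop44Irred` — VERBATIM, same `Sig` bodies; a proof of any
of them for 20165 is a proof here) + ONE new statement `stub_thm52KernelGapsAtP` (20165's `stub_thm52KernelGapsAddv`
with the carrier moved to `p`) + the held `PublishedInputsHeegner` + the idle Gaussian-field supplement
`stub_gaussianSupplement` (the crux body at `d_K = −4`; DROP IT by adding the binder `NumberField.discr K ≠ -4` to the
crux — its one consumer, the J08 road, applies `hJp` at a BFH field with `d_K < −4`; then this skeleton has exactly
20165's seven stub slots). READING behind the cut (FINDING-19941 memo): the `q = p` carrier is bsd-jet's road K4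
`JET.JetchevDivisibilityCarrierAdd` read with `E[p]` irreducible; Jetchev's Lemma 4.3 at `v ∣ p` is replaced by
x11b3's connected-Kummer layer theorem mod [GZ III (3.1)], the Thm 6.3 local quotient is `Φ_v(𝔽_p)/p^m`; §§5–6 are
carrier-blind — so 19941 is NOT beyond Jetchev's method, it is the B-row instance of the same reading as 20165.
v4: `stub_thm52KernelGapsAtP` ↦ `stub_thm52ClosedLocalFacts` (8 closed statements, shared with 20165 v6; p525480/p528465: the H63 structures and Φ-cyclicity are tree theorems); v2.1: `stub_cor32Irred` DROPPED (k8t-c4 g9: h32I false as displayed, its row form a THEOREM p516209; Čebotarev-free assembly p519470) and `stub_prop52Irred`/`stub_coreVertexExistenceIrred` ↦ the PRIMED `…P` forms of 20165 v5 (plan g22 `…v5_primedSigs.lean`, bridge re-issue p521540, K9 twin p522249). `WildJetchevBoundAtP_of` is a REAL proof; `lean check`: sorries ONLY in `stub_*` (7 = stubs_max; 6 after the `d_K ≠ −4` restatement).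
HONEST FRAMING: conditional throughout; nothing booked; the crux, its stubs and BSD are as open as before.

References: [cite: Jetchev2008, Conj. 1.3, Thm. 1.4, Cor. 1.5, Lemma 4.3, Def. 4.8, Prop. 4.9, Thm. 5.1, Thm. 5.2 (p. 821), Prop. 5.3, Rem. 6.2]
[cite: MatarNekovar2019, Thm. 0.7, §0.11] [cite: McCallumLMS1991, §3 Cor. 3.2, §4 Prop. 4.4, §5 Prop. 5.2, Lemma 5.1, Cor. 5.6]
[cite: GrossLMS1991, §3, Prop. 5.3, Prop. 6.2 (1)] [cite: GrossZagier1986, III (3.1)] [cite: MilneADT2006, I Prop. 3.8]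
-/

set_option linter.dupNamespace false
set_option autoImplicit false

noncomputable section

open scoped Classical NumberField Pointwise

open WeierstrassCurve IsDedekindDomain NumberField Literature.NumberTheory.EllipticCurves
  Literature.NumberTheory.EllipticCurves.ModularForms Literature.NumberTheory.EllipticCurves.Jetchev2008
  Literature.NumberTheory.EllipticCurves.Rank1Residual
  Literature.NumberTheory.GaloisRepresentations
  Literature.NumberTheory.GaloisRepresentations.DiscreteGaloisModule
  Summit.BirchSwinnertonDyer.Rank1Residual Summit.BirchSwinnertonDyer.Rank1Residual.X11b
  Summit.BirchSwinnertonDyer.Rank1Residual.JET Summit.BirchSwinnertonDyer.Rank1Residual.JET.SelmerVocabulary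
  Summit.BirchSwinnertonDyer.Rank1Residual.X11b.Three Literature.NumberTheory.GaloisCohomology Field
  Literature.NumberTheory.Automorphic
  Summit.BirchSwinnertonDyer.BirchSwinnertonDyer.Theorems

namespace Summit.BirchSwinnertonDyer.BirchSwinnertonDyer.Cruxes.WildJetchevBoundAtP.Birth

/-- Statement of `stub_structureIrred` (S1): Kolyvagin's structure theorem, UPPER half, under IRREDUCIBILITY of
`E[p]`, with NO reduction-type binder at `p` (McCallum currency): `ord_p #Ш(E/K)[p^∞] + 2t ≤ 2M₀`
(`p^{M₀} ∥ y_K` in `E(K)`) when every derived Heegner point is `p^s`-divisible at every depth `s ≤ t`.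
= `Cha2005.rmk25_padicValNat_card_sha_primary_add_le_of_globalDivisibility` minus `p ∤ d_K`, `p² ∤ N`
(Matar–Nekovář 2019 Thm. 0.7 + §0.11; McCallum 1991 Cor. 5.6). -/
abbrev Sig.stub_structureIrred : Prop :=
  ∀ (W : WeierstrassCurve ℚ) [W.IsElliptic] [W.IsGloballyMinimal] [NeZero (W.conductorNorm ℤ)],
    ¬ W.HasCM →
    ∀ (K : Type) [Field K] [NumberField K], IsImaginaryQuadratic K →
    NumberField.discr K ≠ -3 → NumberField.discr K ≠ -4 →
    SatisfiesHeegnerHypothesis (W.conductorNorm ℤ) K →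
    ∀ (p : ℕ) [Fact p.Prime], p ≠ 2 → W.HasIrreducibleModPGaloisRep p →
    ∀ (Dt : ModularParametrizationData W (W.conductorNorm ℤ)) (β : ℤ) (ι : K →+* ℂ)
      (d₁ : KolyvaginHeegnerData Dt β ι 1) (P : (W.baseChange K).toAffine.Point),
      d₁.toGeomPoints d₁.derivedPoint = toGeomPoints (W.baseChange K) P →
      ¬ IsOfFinAddOrder P →
    ∀ (M₀ : ℕ),
      (∃ Q : (W.baseChange K).toAffine.Point, ((p ^ M₀ : ℕ) : ℤ) • Q = P) →
      (¬ ∃ Q : (W.baseChange K).toAffine.Point, ((p ^ (M₀ + 1) : ℕ) : ℤ) • Q = P) →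
    ∀ (t : ℕ),
      (∀ (s : ℕ), s ≤ t → ∀ (n : ℕ) (d : KolyvaginHeegnerData Dt β ι n), Squarefree n →
        (∀ ℓ ∈ n.primeFactors, Zhang2014.IsKolyvaginPrime (W.conductorNorm ℤ) W K p ℓ ∧
          s ≤ Zhang2014.kolyvaginIndex W p ℓ) →
        ∃ Q : (W.baseChange (ringClassField K ι n)).toAffine.Point,
          ((p ^ s : ℕ) : ℤ) • Q = d.derivedPoint) →
    padicValNat p (Nat.card (AddCommGroup.primaryComponent (W.baseChange K).sha p)) + 2 * t ≤ 2 * M₀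

/-- Statement of `stub_prop52Irred`: McCallum 1991 Prop. 5.2 («`M_r < M ⟹ ∃ c ∈ Λ^r_M` with `ord P(c)` of exact order `p^{M−M_r}`») in the IRREDUCIBLE reading — the `p`-adic-tower / surjectivity binder replaced by `W.HasIrreducibleModPGaloisRep p` (valid under absolute irreducibility by Jetchev 2008 Rem. 6.2: the proof uses the image only through the Čebotarev Cor. 3.2). VERBATIM the hypothesis `h52I` of `divisibilityIrredAddv_of_prop52Irred_of_coreVertexExistenceIrred_of_thm63` (p504855). A READING, displayed, nothing asserted. [cite: McCallumLMS1991, §5 Prop. 5.2 (p. 304), §3 Cor. 3.2] [cite: Jetchev2008, Rem. 6.2] -/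
abbrev Sig.stub_prop52IrredP : Prop :=
   ∀ (W : WeierstrassCurve ℚ) [W.IsElliptic] [W.IsGloballyMinimal] [NeZero (W.conductorNorm ℤ)],
      ¬ W.HasCM →
      ∀ (K : Type) [Field K] [NumberField K], IsImaginaryQuadratic K →
      NumberField.discr K ≠ -3 → NumberField.discr K ≠ -4 →
      SatisfiesHeegnerHypothesis (W.conductorNorm ℤ) K →
      ∀ (p : ℕ) [Fact p.Prime], p ≠ 2 → W.HasIrreducibleModPGaloisRep p → (p : ℤ) ∣ W.conductorNorm ℤ →
      ∀ (Dt : ModularParametrizationData W (W.conductorNorm ℤ)) (β : ℤ) (ι : K →+* ℂ)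
        (d₁ : KolyvaginHeegnerData Dt β ι 1), ¬ IsOfFinAddOrder d₁.derivedPoint →
      ∀ (r : ℕ), 0 < r →
      ∀ (Mr : ℕ),
        IsLeast {u : ℕ | ∃ (n : ℕ) (d : KolyvaginHeegnerData Dt β ι n), Squarefree n ∧
            n.primeFactors.card = r ∧
            (∀ ℓ ∈ n.primeFactors, Zhang2014.IsKolyvaginPrime (W.conductorNorm ℤ) W K p ℓ ∧
              u + 1 ≤ Zhang2014.kolyvaginIndex W p ℓ) ∧
            (∃ Q : (W.baseChange (ringClassField K ι n)).toAffine.Point,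
              ((p ^ u : ℕ) : ℤ) • Q = d.derivedPoint) ∧
            ¬ ∃ Q : (W.baseChange (ringClassField K ι n)).toAffine.Point,
              ((p ^ (u + 1) : ℕ) : ℤ) • Q = d.derivedPoint} Mr →
      ∀ (M : ℕ), Mr < M →
        ∃ (n : ℕ) (d : KolyvaginHeegnerData Dt β ι n), Squarefree n ∧ n.primeFactors.card = r ∧
          (∀ ℓ ∈ n.primeFactors, Zhang2014.IsKolyvaginPrime (W.conductorNorm ℤ) W K p ℓ ∧
            M ≤ Zhang2014.kolyvaginIndex W p ℓ) ∧
          addOrderOf (d.kolyvaginClass (Fact.out : p.Prime) M) = p ^ (M - Mr) ∧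
          (∃ Q : (W.baseChange (ringClassField K ι n)).toAffine.Point,
            ((p ^ Mr : ℕ) : ℤ) • Q = d.derivedPoint) ∧
          ¬ ∃ Q : (W.baseChange (ringClassField K ι n)).toAffine.Point,
            ((p ^ (Mr + 1) : ℕ) : ℤ) • Q = d.derivedPoint

/-- Statement of `stub_coreVertexExistenceIrred`: Jetchev 2008 Prop. 5.3 (= arXiv:math/0703431 Prop. 6.4: a core vertex of every level `m ≥ 1` above a conductor with non-torsion, exactly-`p^s`-divisible derived point and `s + m ≤ M(c)`) in the IRREDUCIBLE reading — bsd-jet's reading binder `JET.JetchevCoreVertexExistence` with its tower binder replaced by `W.HasIrreducibleModPGaloisRep p`. VERBATIM the hypothesis `hCVI` of p504855. A READING, displayed, nothing asserted. [cite: Jetchev2008, Prop. 5.3 (p. 823), Lemma 5.1, Rem. 6.2] -/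
abbrev Sig.stub_coreVertexExistenceIrredP : Prop :=
   ∀ (W : WeierstrassCurve ℚ) [W.IsElliptic] [W.IsGloballyMinimal] [NeZero (W.conductorNorm ℤ)],
      ¬ W.HasCM →
      ∀ (K : Type) [Field K] [NumberField K], IsImaginaryQuadratic K →
      NumberField.discr K ≠ -3 → NumberField.discr K ≠ -4 →
      SatisfiesHeegnerHypothesis (W.conductorNorm ℤ) K →
      ∀ (τ : K ≃ₐ[ℚ] K), τ ≠ 1 →
      ∀ (p : ℕ) [Fact p.Prime], p ≠ 2 → W.HasIrreducibleModPGaloisRep p → (p : ℤ) ∣ W.conductorNorm ℤ →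
      ∀ (Dt : ModularParametrizationData W (W.conductorNorm ℤ)) (β : ℤ) (ι : K →+* ℂ)
        [∀ k : ℕ, NumberField (ringClassField K ι k)]
        (d₁ : KolyvaginHeegnerData Dt β ι 1), ¬ IsOfFinAddOrder d₁.derivedPoint →
      ∀ (m : ℕ), 1 ≤ m →
      ∀ (c : ℕ) (d : KolyvaginHeegnerData Dt β ι c), Squarefree c →
        (∀ ℓ ∈ c.primeFactors, Zhang2014.IsKolyvaginPrime (W.conductorNorm ℤ) W K p ℓ) →
      ∀ (s : ℕ), ¬ IsOfFinAddOrder d.derivedPoint →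
        (∃ Q : (W.baseChange (ringClassField K ι c)).toAffine.Point,
          ((p ^ s : ℕ) : ℤ) • Q = d.derivedPoint) →
        (¬ ∃ Q : (W.baseChange (ringClassField K ι c)).toAffine.Point,
          ((p ^ (s + 1) : ℕ) : ℤ) • Q = d.derivedPoint) →
        ((s + m : ℕ) : ℕ∞) ≤ Zhang2014.levelIndex W p c →
        ∃ (c' : ℕ) (d' : KolyvaginHeegnerData Dt β ι c'), Squarefree c' ∧
          (∀ ℓ ∈ c'.primeFactors, Zhang2014.IsKolyvaginPrime (W.conductorNorm ℤ) W K p ℓ ∧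
            m + s ≤ Zhang2014.kolyvaginIndex W p ℓ) ∧
          Jetchev2008.IsGlobalCoreVertex W K ι τ p m c' ∧
          ¬ IsOfFinAddOrder d'.derivedPoint ∧
          ¬ ∃ Q : (W.baseChange (ringClassField K ι c')).toAffine.Point,
            ((p ^ (s + 1) : ℕ) : ℤ) • Q = d'.derivedPoint

/-- Statement of `stub_prop47IrredP2` (v7c; replaces v3–v6's `stub_prop44Irred` = p508713's `h44I`): McCallum 1991 Prop. 4.4 /
Jetchev 2008 Prop. 4.7 — at a place `λ ∣ ℓ` of `K`, for COMPATIBLE Kolyvagin–Heegner data of conductors `m` and `mℓ` (all prime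
factors Zhang–Kolyvagin of index `≥ M`, `ℓ ≠ 2`), the ORDER COMPARISON `p^j•c_M(mℓ) ∈ Ker_λ ↔ p^j•c_M(m) ∈ Ker_λ` (conjunct (B)
of the v6 text), read with `E[p]` irreducible and PRIMED with `(p : ℤ) ∣ W.conductorNorm ℤ` (fed from `Addv`). = the binder
`h47P2` of k8t-c4 g11's v2 chain VERBATIM. **A THEOREM modulo the published fact Gross 1991 Prop. 3.7 (2)**
(`stub_prop47IrredP2_of_prop37_2` below, = `JetchevIrreducibleProp44.h47P2_of_prop37_2`, p541604). The guard `ℓ ≠ 2` is the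
boundary of the fact as typed (Nekovář 2007 Prop. 4.13 (ii)); it costs nothing (Čebotarev primes avoid any finite set).
[cite: McCallumLMS1991, §4 Prop. 4.4] [cite: Jetchev2008, Prop. 4.4, Prop. 4.7, Rem. 6.2] [cite: GrossLMS1991, Prop. 3.7 (2), Prop. 6.2 (2)]
[cite: Nekovar2007, Prop. 4.13 (ii)] -/
abbrev Sig.stub_prop47IrredP2 : Prop :=
  ∀ (W : WeierstrassCurve ℚ) [W.IsElliptic] [W.IsGloballyMinimal] [NeZero (W.conductorNorm ℤ)],
        ¬ W.HasCM →
        ∀ (K : Type) [Field K] [NumberField K], IsImaginaryQuadratic K →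
        NumberField.discr K ≠ -3 → NumberField.discr K ≠ -4 →
        SatisfiesHeegnerHypothesis (W.conductorNorm ℤ) K →
        ∀ (p : ℕ) [Fact p.Prime], p ≠ 2 → W.HasIrreducibleModPGaloisRep p → (p : ℤ) ∣ W.conductorNorm ℤ →
        ∀ (Dt : ModularParametrizationData W (W.conductorNorm ℤ)) (β : ℤ) (ι : K →+* ℂ)
          (M : ℕ), 1 ≤ M →
        ∀ (m l : ℕ), Squarefree (m * l) → l.Prime → l ≠ 2 → ¬ l ∣ m →
          (∀ l' ∈ (m * l).primeFactors, Zhang2014.IsKolyvaginPrime (W.conductorNorm ℤ) W K p l' ∧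
            M ≤ Zhang2014.kolyvaginIndex W p l') →
        ∀ (d : KolyvaginHeegnerData Dt β ι m) (d' : KolyvaginHeegnerData Dt β ι (m * l)),
          (∀ l' ∈ m.primeFactors, ∀ (x : ringClassField K ι m) (x' : ringClassField K ι (m * l)),
            (x : ℂ) = x' → ((d'.σ l' x' : ringClassField K ι (m * l)) : ℂ) = (d.σ l' x : ℂ)) →
          (∀ s ∈ d.S, ∃ s' ∈ d'.S, ∀ (x : ringClassField K ι m) (x' : ringClassField K ι (m * l)),
            (x : ℂ) = x' → ((s' x' : ringClassField K ι (m * l)) : ℂ) = (s x : ℂ)) →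
          (∀ s' ∈ d'.S, ∃ s ∈ d.S, ∀ (x : ringClassField K ι m) (x' : ringClassField K ι (m * l)),
            (x : ℂ) = x' → ((s' x' : ringClassField K ι (m * l)) : ℂ) = (s x : ℂ)) →
          (∀ (x : ringClassField K ι m) (x' : ringClassField K ι (m * l)),
            (x : ℂ) = x' → d'.emb x' = d.emb x) →
        ∀ (v : HeightOneSpectrum (𝓞 K)), (l : 𝓞 K) ∈ v.asIdeal →
        ∀ (j : ℕ),
          (((p ^ j : ℕ) : ℤ) • d'.kolyvaginClass (Fact.out : p.Prime) M ∈
              (W.baseChange K).torsionLocalKer (v.adicCompletion K) ((p ^ M : ℕ) : ℤ) ↔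
            ((p ^ j : ℕ) : ℤ) • d.kolyvaginClass (Fact.out : p.Prime) M ∈
              (W.baseChange K).torsionLocalKer (v.adicCompletion K) ((p ^ M : ℕ) : ℤ))

/-! `stub_thm52NamedPrint` below is the NAMED-PRINT-ONLY re-cut of `stub_thm52ClosedLocalFacts` (registered: 20165 v6 / 19941 v4,
eight closed statements): conjunct (1) `hPT` BYTE-FOR-BYTE; conjunct (3) `hGZ` RE-CLOSED WITH THE PRINTED GUARDS (bsd-jet read-1
ADD-9 ANNEX-5 §2: the unguarded `∀ W p m` closure is satisfiability-unverified); conjuncts (2) `h53` (Gross 5.3: the sign of the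
Kolyvagin class is a THEOREM on the irreducible row, k9-c4 g9 p533295), (4) `hloc`, (5) `h𝒯σ`, (6) `h𝒯sd`, (7) `htr` (bsd-jet
theorems of 2026-08-27, fed by name since p531200/p532411) and (8) `h49str` (Jetchev Prop. 4.9 proper — a THEOREM given `hGZ` on the
irreducible row, k9-c4 g9 p535775, irreducible port of bsd-jet pv-1 g7's K-GAP-2 p532810) DROPPED. Same text on both items (SHARED:
one proof, `--supports` both). -/

/-- Statement of `stub_thm52NamedPrint` (NEW, **hardest**; replaces `stub_thm52ClosedLocalFacts`): the conjunction of TWO CLOSED,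
image-free, row-free NAMED-PRINT statements from which k9-c4 g9's end forms
`JetchevIrreducibleReadingThm52NamedPrintOnly.h63IRowObjectsAddv_of_poitouTate_of_GZ31` (20165's node `Sig.H63IRowObjectsAddv`, carrier
`q ≠ p`) and `WildJetchevBoundAtPNamedPrintOnly.thm63AtP_of_poitouTate_of_GZ31` (19941's H63Ip, carrier at `p`) prove [J] Thm. 5.2 for
the row objects together with `stub_prop44Irred`:
(1) `hPT` — Poitou–Tate duality for the tree's Selmer structures at every number field (named fact
`JET.poitouTate_selmerStructure_duality_conj`; Milne ADT I Thm. 4.10 + local Tate duality with a conjugation-compatible perfect family;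
bsd-jet ARM P) — NAMED PRINT;
(2) `hGZ` — [GZ86 III (3.1)] / Gross 1991 §6 (proof of Prop. 6.2 (1)) in the receptacle form: ONE `n′` prime to `p` with
`n′ • y_m^γ ∈ E⁰(K̄_v)` (and the same for `y_{m/ℓ}` read at level `m`) at every bad place `v` of `E/K`, CLOSED WITH THE PRINTED
GUARDS: `K` a Heegner field for `N_E`, `p` odd with `E[p]` irreducible (so `E(ℚ)[p] = 0` and `n′ := #E(ℚ)_tors` is prime to `p`),
`m` square-free with Zhang–Kolyvagin prime factors (so `m ≥ 1`, `gcd(m, N_E) = 1` — Gross §3 «n ≥ 1 … prime to N») — NAMED PRINT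
(schema). NOTE for the typer/planner: the tree's Literature fact `Gross1991_heegnerPoint_sub_ratTorsion_mem_E0` (p471738) is
Gross-scoped (`ρ̄_{E,p}` ONTO, `E` non-CM, `d_K ∉ {−3,−4}`), so it does NOT feed (2) on the irreducible non-surjective rows of this
crux; the printed source [GZ86 III (3.1)] is image-free (a statement about Heegner divisors on `X₀(N)`), so (2) wants an
image-free re-type of that fact (bsd-jet ty g8's T4 transport `hGZ_of_Gross1991` then ports verbatim).
WHY IT MIGHT FAIL: (1) is conjecture-shaped pending ARM P; (2) is printed ([GZ86 III (3.1)] at every bad place incl. `p² ∣ N`; no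
primary text held, acq-00078) but not a tree theorem, and its only typed form is surjective-scoped. Sources: k9-c4 g9 p531200, p532411,
p533295, p535775, p536529 + the `…NamedPrintOnly` end forms; bsd-jet `Rank1ResidualJetCarrierMultEndFormClosed.lean`, sheets
PV2-J6-KERNEL ADD-4/5, D-AUDIT-JET-read-1 ADD-9 ANNEX-5. [cite: Jetchev2008, Prop. 4.9, Thm. 5.1, Thm. 5.2 (p. 821)]
[cite: GrossZagier1986, III (3.1)] [cite: GrossLMS1991, §3, §6 Prop. 6.2 (1)] [cite: MilneADT2006, Ch. I, Thm. 4.10(b)] -/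
abbrev Sig.stub_thm52NamedPrint : Prop :=
    (∀ (K : Type) [Field K] [NumberField K], poitouTate_selmerStructure_duality_conj K) ∧
    (∀ (W : WeierstrassCurve ℚ) [W.IsElliptic] [W.IsGloballyMinimal] [NeZero (W.conductorNorm ℤ)]
      (K : Type) [Field K] [NumberField K], IsImaginaryQuadratic K →
      SatisfiesHeegnerHypothesis (W.conductorNorm ℤ) K →
      ∀ (p : ℕ) [Fact p.Prime], p ≠ 2 → W.HasIrreducibleModPGaloisRep p →
      ∀ (Dt : ModularParametrizationData W (W.conductorNorm ℤ)) (β : ℤ) (ι : K →+* ℂ)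
      [∀ j : ℕ, NumberField (ringClassField K ι j)],
      ∃ n' : ℤ, IsCoprime (p : ℤ) n' ∧ ∀ (m : ℕ), Squarefree m →
        (∀ q ∈ m.primeFactors, Zhang2014.IsKolyvaginPrime (W.conductorNorm ℤ) W K p q) →
        ∀ (dm : KolyvaginHeegnerData Dt β ι m)
        (γ : ringClassField K ι m ≃ₐ[ℚ] ringClassField K ι m), γ ∈ ringClassGal ι m →
        ∀ v : HeightOneSpectrum (𝓞 K), ¬ (W.baseChange K).HasGoodReductionAt v →
          n' • pointsMap (W.baseChange K) (v.adicCompletion K)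
              (dm.toGeomPoints (pointGalHom W (ringClassField K ι m) γ dm.y)) ∈
            E0Receptacle (W.baseChange K) v ∧
          ∀ (ℓ : ℕ), ℓ ∈ m.primeFactors → ∀ (dm' : KolyvaginHeegnerData Dt β ι (m / ℓ))
            (hle : ringClassField K ι (m / ℓ) ≤ ringClassField K ι m),
            n' • pointsMap (W.baseChange K) (v.adicCompletion K)
                (dm.toGeomPoints (pointGalHom W (ringClassField K ι m) γ
                  (WeierstrassCurve.Affine.Point.map (W' := W)
                    ((RingClassField.inclusion ι hle).restrictScalars ℚ) dm'.y))) ∈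
              E0Receptacle (W.baseChange K) v)

/-- S2p — at-`p` divisibility at conductor level (the `hDp` schema of p518161; PROVED below from four stubs, not a stub):
on a frame of level `N_E` whose conductor-`1` derived point has infinite order, every derived Heegner point `P_n` is
`p^s`-divisible in `E(K[n])` for all `s ≤ ord_p c_p(E)` — the `q = p` share of Jetchev's Conj. 1.3, irreducible reading
of bsd-jet's K4 `JET.JetchevDivisibilityCarrierAdd`. [cite: Jetchev2008, Conj. 1.3, Thm. 1.4] -/
abbrev Sig.S2pDivisibilityAtP : Prop :=
  ∀ (W : WeierstrassCurve ℚ) [W.IsElliptic] [W.IsGloballyMinimal] [NeZero (W.conductorNorm ℤ)],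
      ¬ W.HasCM →
      ∀ (K : Type) [Field K] [NumberField K], IsImaginaryQuadratic K →
      NumberField.discr K ≠ -3 → NumberField.discr K ≠ -4 →
      SatisfiesHeegnerHypothesis (W.conductorNorm ℤ) K →
      ∀ (p : ℕ) [Fact p.Prime], p ≠ 2 → W.analyticRank = 0 → Addv W p → 0 ≤ padicValRat p W.j →
      W.HasIrreducibleModPGaloisRep p → ¬ (∀ n : ℕ, W.HasSurjectiveModNGaloisRep (p ^ n : ℕ)) →
      (∃ Dt : ModularParametrizationData W (W.conductorNorm ℤ),
        (∀ z ∈ Dt.L.lattice, ∃ w ∈ periodLattice Dt.f, z = (Dt.c : ℂ) * w) ∧ ¬ (p : ℤ) ∣ Dt.c) →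
      ∀ (Dt : ModularParametrizationData W (W.conductorNorm ℤ)) (β : ℤ) (ι : K →+* ℂ)
        (d₁ : KolyvaginHeegnerData Dt β ι 1), ¬ IsOfFinAddOrder d₁.derivedPoint →
      ∀ (s : ℕ), s ≤ padicValNat p ((W.baseChange ℚ_[p]).localTamagawaNumber ℤ_[p]) →
      ∀ (n : ℕ) (d : KolyvaginHeegnerData Dt β ι n), Squarefree n →
        (∀ ℓ ∈ n.primeFactors, Zhang2014.IsKolyvaginPrime (W.conductorNorm ℤ) W K p ℓ ∧
          s ≤ Zhang2014.kolyvaginIndex W p ℓ) →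
        ∃ Q : (W.baseChange (ringClassField K ι n)).toAffine.Point,
          ((p ^ s : ℕ) : ℤ) • Q = d.derivedPoint

/-- Statement of `stub_gaussianSupplement` (idle for the route; DROP by restating the crux with `NumberField.discr K ≠ -4`):
the crux body at the Gaussian field `d_K = −4` — the instances S1 (MN19 Thm. 0.7, printed for `D_K ≠ −3, −4`) does not
cover and the J08 road never uses (`p ∣ N` split in `ℚ(i)` forces `p ≡ 1 (4)`, so `ord_p c_p = 0` there and the
content is the MN19 Thm. 0.3-type bound at `ℚ(i)`, Gross's `u_K = 2` normalisation). = `h4` of p518161 §3.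
[cite: MatarNekovar2019, Thm. 0.3, Thm. 0.7 (D_K ≠ −3, −4)] [cite: GrossLMS1991, §3 (u_K)] -/
abbrev Sig.stub_gaussianSupplement : Prop :=
  ∀ (N : ℕ) [NeZero N] (W : WeierstrassCurve ℚ) [W.IsElliptic] [W.IsGloballyMinimal]
    (K : Type) [Field K] [NumberField K],
    IsImaginaryQuadratic K → NumberField.discr K = -4 → SatisfiesHeegnerHypothesis N K →
    ∀ (p : ℕ) [Fact p.Prime], p ≠ 2 → W.analyticRank = 0 → Addv W p → 0 ≤ padicValRat p W.j →
    ¬ W.HasCM → W.HasIrreducibleModPGaloisRep p → ¬ (∀ n : ℕ, W.HasSurjectiveModNGaloisRep (p ^ n : ℕ)) →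
    (∃ Dt : ModularParametrizationData W N,
      (∀ z ∈ Dt.L.lattice, ∃ w ∈ periodLattice Dt.f, z = (Dt.c : ℂ) * w) ∧ ¬ (p : ℤ) ∣ Dt.c) →
    ∀ {P : (W.baseChange K).toAffine.Point}, IsHeegnerPoint N W K P → ¬ IsOfFinAddOrder P → p ∣ N →
    padicValNat p (Nat.card (AddCommGroup.primaryComponent (W.baseChange K).sha p)) +
        2 * padicValNat p ((W.baseChange ℚ_[p]).localTamagawaNumber ℤ_[p]) ≤
      2 * padicValNat p (AddSubgroup.zmultiples P).index

/-- Statement of `stub_publishedInputsHeegner` (cite; the K9 route's held conjunction, item 19914). -/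
abbrev Sig.stub_publishedInputsHeegner : Prop :=
  Summit.BirchSwinnertonDyer.BirchSwinnertonDyer.Theses.KatoDescentPotSupersingular.PublishedInputsHeegner


/-- S1 — registered stub of 20165 (shared verbatim). -/
theorem stub_structureIrred : Sig.stub_structureIrred := by
  sorry

/-- McCallum Prop. 5.2, irreducible reading, PRIMED (`p ∣ N_E`) — 20165 v5's stub (shared verbatim). -/
theorem stub_prop52IrredP : Sig.stub_prop52IrredP := by
  sorry

/-- Jetchev Prop. 5.3, irreducible reading, PRIMED (`p ∣ N_E`) — 20165 v5's stub (shared verbatim). -/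
theorem stub_coreVertexExistenceIrredP : Sig.stub_coreVertexExistenceIrredP := by
  sorry

/-- McCallum Prop. 4.4 / Jetchev Prop. 4.7 — primed, (B)-only, `ℓ ≠ 2` — shared with 20165 v7c verbatim. -/
theorem stub_prop47IrredP2 : Sig.stub_prop47IrredP2 := by
  sorry

/-- **S5 DISCHARGED modulo ONE published fact** (Gross 1991 Prop. 3.7 (2)): k8t-c4 g11's
`JetchevIrreducibleProp44.h47P2_of_prop37_2` (p541604). A REAL proof, conditional on the named fact only.
[cite: GrossLMS1991, Prop. 3.7 (2)] [cite: McCallumLMS1991, §4 Prop. 4.4] -/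
theorem stub_prop47IrredP2_of_prop37_2
    (h37 : Literature.NumberTheory.EllipticCurves.GrossLMS1991.prop37_2_frobeniusCongruence) :
    Sig.stub_prop47IrredP2 :=
  JetchevIrreducibleProp44.h47P2_of_prop37_2 h37

/-- bsd-jet's closed end-form statements (shared with 20165 v6 and bsd-jet's register). -/
theorem stub_thm52NamedPrint : Sig.stub_thm52NamedPrint := by
  sorry

/-- The K9 route's held `PublishedInputsHeegner` (cite). -/
theorem stub_publishedInputsHeegner : Sig.stub_publishedInputsHeegner := by
  sorry

/-- The idle `d_K = −4` supplement (drop by restating the crux). -/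
theorem stub_gaussianSupplement : Sig.stub_gaussianSupplement := by
  sorry

/-- **S2p (at-`p` divisibility at conductor level) is PROVED from four stubs** (p520230 §1 ∘ §2, `hRCF` discharged by
`JET.numberField_ringClassField`). A REAL proof. [cite: Jetchev2008, Thm. 1.4 (proof), Thm. 5.2, Prop. 5.3] -/
theorem S2pDivisibilityAtP_of (h52 : Sig.stub_prop52IrredP) (hCV : Sig.stub_coreVertexExistenceIrredP)
    (h47 : Sig.stub_prop47IrredP2) (hLF : Sig.stub_thm52NamedPrint) :
    Sig.S2pDivisibilityAtP :=
  WildJetchevBoundAtPCoreVertexBridgePrimed.divisibilityAtP_of_prop52IrredP_of_coreVertexExistenceIrredP_of_thm63AtP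
    h52 hCV (fun K _ _ ι hK k ↦ Summit.BirchSwinnertonDyer.Rank1Residual.JET.numberField_ringClassField K hK ι k)
    (JetchevIrreducibleH63P2.thm63AtP_of_poitouTate_of_GZ31_of_prop47P2 h47 hLF.1 hLF.2)

/-- **The crux from the eight stubs** (p518161 §3 fed with S1, the proved S2p, PIH and the supplement), concluding the
K9 route decl BY NAME. A REAL proof; sorries only inside the stubs. [cite: Jetchev2008, Cor. 1.5 (p. 812)]
[cite: MatarNekovar2019, Thm. 0.7, §0.11] -/
theorem WildJetchevBoundAtP_of (hS : Sig.stub_structureIrred) (h52 : Sig.stub_prop52IrredP)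
    (hCV : Sig.stub_coreVertexExistenceIrredP) (h47 : Sig.stub_prop47IrredP2)
    (hKG : Sig.stub_thm52NamedPrint) (hH : Sig.stub_publishedInputsHeegner) (h4 : Sig.stub_gaussianSupplement) :
    Summit.BirchSwinnertonDyer.BirchSwinnertonDyer.Theses.KatoDescentPotSupersingular.WildJetchevBoundAtP :=
  WildJetchevBoundAtPOfStubs.wildJetchevBoundAtP_of_structureIrred_of_divisibilityAtP_of_gaussianSupplement hS
    (S2pDivisibilityAtP_of h52 hCV h47 hKG) hH h4

/-- Sanity composition with the sorried stubs. -/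
theorem wildJetchevBoundAtP_of_stubs :
    Summit.BirchSwinnertonDyer.BirchSwinnertonDyer.Theses.KatoDescentPotSupersingular.WildJetchevBoundAtP :=
  WildJetchevBoundAtP_of stub_structureIrred stub_prop52IrredP stub_coreVertexExistenceIrredP stub_prop47IrredP2
    stub_thm52NamedPrint stub_publishedInputsHeegner stub_gaussianSupplement

end Summit.BirchSwinnertonDyer.BirchSwinnertonDyer.Cruxes.WildJetchevBoundAtP.Birth

end
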